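import Mathlib.Topology.Algebra.OpenSubgroup
import Literature.AnabelianGeometry.SemiGraphs.ArithTemperedGroupOfOuterAction
import HarnessLib

/-!
# [SemiAnbd] Prop 5.2 (iv) / Thm 5.4, producer row T54-B: openness of `aug(𝓚)` in `Π_A` for subgroups
# `𝓚` of the outer semi-direct product model (the continuity binder hK1′ reduced to `ρ`)

Mochizuki, *Semi-graphs of anabelioids*, Publ. RIMS **42** (2006), §5 Def 5.1 (i)(c)(d) p. 62,
Prop 5.2 (iii)(iv) p. 64 [cite: MochizukiSemiAnbd2006, Def 5.1 (i), p. 62].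

PROOF-ONLY sequel (no definitions) of `ArithTemperedGroupOfOuterAction.lean` (p416276).  The TEMPERATION
ENGINE of abc-iut-L3-d2 (`TemperedExtensionBasis/Tempered.lean`, `exists_arithTemperedGroup_of_kernelSeq`)
and the arithmetic tower of abc-iut-L3-d4 need, for each member `𝓚 n` of the neighbourhood basis of
`Π^temp_𝔊`, the CONTINUITY BINDER hK1′: «`aug(𝓚 n)` is open in `Π_A`» (L3-d4 STATUS 2026-08-26T02:23:53Z
(2)).  For `Π^temp_𝔊 := π₁^temp(𝒢) ⋊^out_ρ Π_A` an element over `a ∈ Π_A` is a pair `(φ, a)` with `φ`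
ANY representative of `ρ a`; hence (this file):

* `mem_map_snd_iff` : `a ∈ aug(𝓚) ↔ ∃ φ, TopOut.mk φ = ρ a ∧ (φ, a) ∈ 𝓚`;
* `isOpen_map_snd_of_forall_exists_rep` : if some OPEN subgroup `U ≤ Π_A` has, for every `a ∈ U`,
  a representative `φ` of `ρ a` with `(φ, a) ∈ 𝓚`, then `aug(𝓚)` is open;
* `isOpen_map_snd_of_rep_condition` : the form the tower uses — `𝓚 ⊇ {(φ, a) | P φ ∧ a ∈ V}` for a
  condition `P` on `Aut_top(π₁^temp 𝒢)` (e.g. «`φ ≡ id mod N n` and `φ` fixes the level-`n` coset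
  graph») and an OPEN subgroup `V ≤ Π_A` (e.g. Def 5.1 (i)(c)'s subgroup acting trivially on `𝔾`):
  then `aug(𝓚)` is open as soon as «`ρ a` has a representative satisfying `P` for all `a` in some open
  subgroup» — i.e. hK1′ is REDUCED to Def 5.1 (i)(c) plus the CONTINUITY OF THE OUTER ACTION `ρ`
  modulo the level (the content of Def 5.1 (i)(c) "continuous outer representations" + (d), Prop 5.2
  (iii)), stated as the binder `hρ`; nothing else about `Π^temp_𝔊` enters.

No side taken on [IUTchIII] Cor 3.12; typed ≠ proved.
-/

namespace Literature.AnabelianGeometry.SemiGraphs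

open Literature.AnabelianGeometry.EtaleTheta Topology

universe u w

section OpenImage

variable {G : Type*} [Group G] [TopologicalSpace G] {J : Type*} [Group J] (ρ : J →* TopOut G)

/-- Membership in `aug(𝓚)`: `a ∈ aug(𝓚)` iff some representative `φ` of `ρ a` gives `(φ, a) ∈ 𝓚`.
[cite: MochizukiSemiAnbd2006, §0 p.5] -/
theorem mem_map_outerSemidirectProductSnd_iff (K : Subgroup (outerSemidirectProduct ρ)) (a : J) :
    a ∈ K.map (outerSemidirectProductSnd ρ) ↔
      ∃ (φ : contMulAut G) (h : TopOut.mk G φ = ρ a), (⟨(φ, a), h⟩ : outerSemidirectProduct ρ) ∈ K := by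
  constructor
  · rintro ⟨p, hp, rfl⟩
    refine ⟨p.1.1, p.2, ?_⟩
    have hp' : p ∈ K := hp
    have : (⟨(p.1.1, outerSemidirectProductSnd ρ p), p.2⟩ : outerSemidirectProduct ρ) = p :=
      Subtype.ext (Prod.ext rfl rfl)
    rw [this]
    exact hp'
  · rintro ⟨φ, h, hmem⟩
    exact ⟨⟨(φ, a), h⟩, hmem, rfl⟩

variable [TopologicalSpace J]

/-- **hK1′ reduced to representatives**: if an OPEN subgroup `U ≤ Π_A` admits, for each `a ∈ U`, a
representative `φ` of `ρ a` with `(φ, a) ∈ 𝓚`, then `aug(𝓚)` is open (it is a subgroup containing the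
open subgroup `U`). [cite: MochizukiSemiAnbd2006, Prop 5.2 (iv), p. 64] -/
theorem isOpen_map_outerSemidirectProductSnd_of_forall_exists_rep [ContinuousMul J]
    (K : Subgroup (outerSemidirectProduct ρ)) (U : Subgroup J) (hU : IsOpen (U : Set J))
    (h : ∀ a ∈ U, ∃ (φ : contMulAut G) (h : TopOut.mk G φ = ρ a),
      (⟨(φ, a), h⟩ : outerSemidirectProduct ρ) ∈ K) :
    IsOpen (K.map (outerSemidirectProductSnd ρ) : Set J) := by
  apply Subgroup.isOpen_mono (H₁ := U) _ hU
  intro a ha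
  exact (mem_map_outerSemidirectProductSnd_iff ρ K a).mpr (h a ha)

/-- **hK1′ reduced to the continuity of `ρ` and Def 5.1 (i)(c)**: if `𝓚` contains every `(φ, a)` with
`P φ` and `a ∈ V` — `P` a condition on automorphisms of `π₁^temp(𝒢)` (e.g. congruence to the identity
modulo the level-`n` open normal subgroup together with triviality on the level-`n` coset graph), `V` an
OPEN subgroup of `Π_A` (e.g. the subgroup of Def 5.1 (i)(c) acting trivially on `𝔾`) — and `ρ a` has a
representative satisfying `P` for every `a` in some open subgroup `W` (continuity of the outer action,
binder `hρ`), then `aug(𝓚)` is open. [cite: MochizukiSemiAnbd2006, Def 5.1 (i), p. 62] -/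
theorem isOpen_map_outerSemidirectProductSnd_of_rep_condition [ContinuousMul J]
    (K : Subgroup (outerSemidirectProduct ρ)) (P : contMulAut G → Prop) (V : Subgroup J)
    (hV : IsOpen (V : Set J))
    (hK : ∀ (φ : contMulAut G) (a : J) (h : TopOut.mk G φ = ρ a), P φ → a ∈ V →
      (⟨(φ, a), h⟩ : outerSemidirectProduct ρ) ∈ K)
    (hρ : ∃ W : Subgroup J, IsOpen (W : Set J) ∧ ∀ a ∈ W, ∃ φ : contMulAut G, TopOut.mk G φ = ρ a ∧ P φ) :
    IsOpen (K.map (outerSemidirectProductSnd ρ) : Set J) := by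
  obtain ⟨W, hW, hrep⟩ := hρ
  refine isOpen_map_outerSemidirectProductSnd_of_forall_exists_rep ρ K (V ⊓ W)
    ((Subgroup.isOpen_mono (H₁ := V ⊓ W) le_rfl (hV.inter hW))) ?_
  intro a ha
  obtain ⟨φ, hφ, hP⟩ := hrep a ha.2
  exact ⟨φ, hφ, hK φ a hφ hP ha.1⟩

omit [TopologicalSpace J] in
/-- Conversely `aug(𝓚) ⊇ U` forces representatives: every `a ∈ U` has SOME representative `φ` of `ρ a`
with `(φ, a) ∈ 𝓚` — so the hypothesis of `isOpen_…_of_forall_exists_rep` is also necessary for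
`U ≤ aug(𝓚)`. [cite: MochizukiSemiAnbd2006, Prop 5.2 (iv), p. 64] -/
theorem forall_exists_rep_of_le_map_outerSemidirectProductSnd (K : Subgroup (outerSemidirectProduct ρ))
    (U : Subgroup J) (hU : U ≤ K.map (outerSemidirectProductSnd ρ)) :
    ∀ a ∈ U, ∃ (φ : contMulAut G) (h : TopOut.mk G φ = ρ a),
      (⟨(φ, a), h⟩ : outerSemidirectProduct ρ) ∈ K :=
  fun a ha => (mem_map_outerSemidirectProductSnd_iff ρ K a).mp (hU ha)

omit [TopologicalSpace J] in
/-- The `π₁^temp(𝒢)`-trace of `𝓚`: `ι⁻¹(𝓚) = {x | (conj x, 1) ∈ 𝓚}` — the other datum (hK1/hK3) the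
temperation engine reads, in representative form. [cite: MochizukiSemiAnbd2006, §0 p.5] -/
theorem mem_comap_toOuterSemidirectProduct_iff [IsTopologicalGroup G]
    (K : Subgroup (outerSemidirectProduct ρ)) (x : G) :
    x ∈ K.comap (toOuterSemidirectProduct ρ) ↔ toOuterSemidirectProduct ρ x ∈ K := Iff.rfl

end OpenImage

end Literature.AnabelianGeometry.SemiGraphs
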